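import Literature.Computability.QuantumComplexity.UnitalStrangeThreshold
import HarnessLib

/-!
# The unital `n → 1` Strange-state threshold law: one fractional knapsack per blocklength

Sequel to `UnitalStrangeThreshold` (the unital ceiling `3ᵐ ≤ (3 − 4ε)ⁿ`, the exact unital `2 → 1` region). For the
bistochastic (= unital free, `Unital.exists_ustoch_iff`) phase-space class `UStoch n 1` we decide, blocklength by
blocklength, when `𝕊_ε^{⊗n} ↦ 𝕊` EXACTLY is possible. Letters: `a = a_ε = (3−ε)/18` (off-origin value of `W_{𝕊_ε}`),
`b = b_ε = −(3−4ε)/9` (origin value), `8a = 1 − b`; `k(u)` = number of origin coordinates of `u ∈ (ℤ₃²)ⁿ`.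
* §1 COLUMN REDUCTION (all `n`, `exists_ustoch_iff_col`): a bistochastic `9ⁿ × 9` matrix converting `𝕊_ε^{⊗n}` to
  `𝕊` exists iff ONE admissible origin column `x : (ℤ₃²)ⁿ → [0,1]`, `9·Σ x = 9ⁿ`, of value `Σ_u W(u)x(u) = −1/3`
  exists — a FRACTIONAL KNAPSACK over the `n + 1` Wigner levels `a^{n−k}b^k` of sizes `C(n,k)8^{n−k}`.
* §2 LP DUALITY: the Lagrangian dual `D(τ) = 9ⁿ⁻¹τ + Σ_u min(W(u) − τ, 0)` bounds every admissible column from below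
  (`dualD_le`); admissible columns are convex with the flat column of value `1/9`, so feasible ⇔ `LPmin ≤ −1/3`.
* §3 LEVELS: class / level indicators `cls`, `lvl` with `Σ_u lvl k = C(n,k)8^{n−k}`, `Σ_u W·lvl k = C(n,k)b^k(1−b)^{n−k}`.
* §4 HEADLINE LAW (`unital_blocklength_law`): for `ε ≤ 3/4`, `5 ≤ n` and the VISIBLE capacity hypothesis
  `9ⁿ⁻¹ ≤ n·8ⁿ⁻¹` (true exactly for `n ≤ 29`), a unital `n → 1` map exists iff `3·2ⁿ⁻¹ ≤ (3 − 4ε)(3 − ε)ⁿ⁻¹`: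
  (←) the symmetric weight-one column of value `9ⁿ⁻¹aⁿ⁻¹b`; (→) on `3/7 ≤ ε` (`|b| ≤ a`) every level is `≥ aⁿ⁻¹b`
  and `Unital.floor_map` applies, on `ε ≤ 3/7` the inequality holds outright. Thresholds `ρ₅ ≈ 0.46117 < ρ₆ ≈
  0.50284 < … < ρ₂₉ ≈ 0.72871 (↑ 3/4)` against the abstract law `5/3 ≤ (5/3 − 8ε/9)ⁿ` (`Blocklength.blocklength_iff`).
* §5 ROW `n = 3` (`ε ≤ 3/7`: `|b| ≥ a`, levels sorted by parity of `k`): `3 → 1` iff `4ε³ − 19ε² + 33ε ≤ 9`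
  (`ρ₃ ≈ 0.33163`); greedy column `𝟙[k=3] + μ𝟙[k=1]` and dual slope `aⁿ⁻¹b`, both typed for `n ∈ {3, 4}` (the
  `n = 4` row, `ρ₄ ≈ 0.40744`, is NOT filed here); no unital `3 → 1` / `4 → 1` map on `3/7 ≤ ε ≤ 3/4`.
* §6 the crossover `ε = 3/7`: unital blocklength EXACTLY 5, abstract EXACTLY 3; rational rows of the ladder.

HONEST SCOPE (clauses of `UnitalStrangeThreshold`). Abstract ℂ-linear bistochastic phase-space maps (`UStoch`):
positivity / complete positivity NOT imposed — every (←) is achievability in the ABSTRACT unital class only and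
bounds no physical protocol from below; every (→) constrains every maximally-mixed-preserving free operation with
these exact input / output states; ancilla-assisted / postselected / approximate protocols are NOT constrained;
target exactly `𝕊` (`m = 1`); from `n = 30` on the weight-one column is inadmissible and the law is NOT claimed
either way; `d = 3`. Nothing here bears on BQP vs BPP. DISCLOSED: the private casts / nine-point sums
`wigner_depolStrange_cast`, `wignerN_depolStrange_cast`, `im_depolStrange`, `re_depolStrange`, `sum_phase_ite`,
`sum_phasePt_one_ite`, `sum_wS` of `UnitalStrangeThreshold` are private THERE and re-derived privately here.

Sources: [cite: KoukoulekidisJennings2022, Thm. 1 & §«Magic distillation bounds for unital protocols» (arXiv p. 8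
L62–66, p. 9 L30–62: `n` even and `ε ≤ 3/7` assumed, `R_num` numerical) & Suppl. Note 3 (p. 33 L11–12: the `u > v`
regime)]; [cite: MarshallOlkinArnold2011, Ch. 2 §A, Ch. 14 §A–B (d-majorization, relative Lorenz curves)]; [cite:
VeitchEtAl2012, §2–3]; [cite: VeitchEtAl2013, §4.4]; [cite: Gross2006, §III].
-/

noncomputable section

namespace Literature.Computability.QuantumComplexity.QutritWigner.Completeness.Unital.Blocklength

open Matrix
open scoped ComplexOrder

variable {n : ℕ}

/-! ### §0 Real Wigner tables (private re-derivations of the private casts of `UnitalStrangeThreshold`) -/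

/-- `W_{𝕊_ε} = wS ε` as a real cast. [cite: VeitchEtAl2013, §4.4] -/
private theorem wigner_depolStrange_cast (ε : ℝ) (p : ZMod 3 × ZMod 3) :
    wigner (depol ε strangeOp) p = ((wS ε p : ℝ) : ℂ) := by
  rw [wigner_depol_strangeOp]; rfl

/-- `W_{𝕊_ε^{⊗n}}(u) = ∏ᵢ wS ε (uᵢ)` as a real cast. [cite: VeitchEtAl2012, §2 (product states)] -/
private theorem wignerN_depolStrange_cast (ε : ℝ) (u : PhasePt n) :
    wignerN (tensorOp fun _ : Fin n => depol ε strangeOp) u = ((∏ i, wS ε (u i) : ℝ) : ℂ) := by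
  rw [wignerN_tensorOp, Complex.ofReal_prod]
  simp_rw [wigner_depolStrange_cast]

/-- `W_{𝕊}(v) = wS 0 (v 0)` on one qutrit, as a real cast (`depol_zero`). [cite: VeitchEtAl2013, §4.4] -/
private theorem wignerN_strange_one_cast (v : PhasePt 1) :
    wignerN (tensorOp fun _ : Fin 1 => strangeOp) v = ((wS 0 (v 0) : ℝ) : ℂ) := by
  have h := wignerN_depolStrange_cast (n := 1) 0 v
  rwa [depol_zero, Fin.prod_univ_one] at h

/-- `W_{𝕊_ε^{⊗n}}` is real. [cite: Gross2006, §III] -/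
private theorem im_depolStrange (ε : ℝ) (u : PhasePt n) :
    (wignerN (tensorOp fun _ : Fin n => depol ε strangeOp) u).im = 0 := by
  rw [wignerN_depolStrange_cast, Complex.ofReal_im]

/-- `Re W_{𝕊_ε^{⊗n}}(u) = ∏ᵢ wS ε (uᵢ)`. [cite: VeitchEtAl2012, §2] -/
private theorem re_depolStrange (ε : ℝ) (u : PhasePt n) :
    (wignerN (tensorOp fun _ : Fin n => depol ε strangeOp) u).re = ∏ i, wS ε (u i) := by
  rw [wignerN_depolStrange_cast, Complex.ofReal_re]

/-- `Σ_a (x at the origin, y elsewhere) = x + 8y` over the nine phase points. [folklore] -/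
private theorem sum_phase_ite (x y : ℝ) :
    ∑ a : ZMod 3 × ZMod 3, (if a = (0, 0) then x else y) = x + 8 * y := by
  have h : ∀ a : ZMod 3 × ZMod 3, (if a = (0, 0) then x else y) = y + if a = (0, 0) then x - y else 0 := by
    intro a; split_ifs <;> ring
  simp_rw [h]
  rw [Finset.sum_add_distrib, Finset.sum_const, Finset.card_univ, Fintype.card_prod, ZMod.card,
    Finset.sum_ite_eq' Finset.univ ((0 : ZMod 3), (0 : ZMod 3)), if_pos (Finset.mem_univ _), nsmul_eq_mul]
  push_cast
  ring

/-- The same sum over `PhasePt 1`. [folklore] -/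
private theorem sum_phasePt_one_ite (x y : ℝ) :
    ∑ v : PhasePt 1, (if v 0 = (0, 0) then x else y) = x + 8 * y := by
  rw [← sum_phase_ite x y]
  exact Fintype.sum_equiv (Equiv.funUnique (Fin 1) (ZMod 3 × ZMod 3)) _ _ fun v => rfl

/-- `Σ_a wS ε a = 1` (unit trace). [cite: VeitchEtAl2012, §3] -/
private theorem sum_wS (ε : ℝ) : ∑ a, wS ε a = 1 := by
  unfold wS; rw [sum_phase_ite]; ring

/-- `Σ_u W_{𝕊_ε^{⊗n}}(u) = 1` (unit trace, Fubini). [cite: VeitchEtAl2012, §3] -/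
private theorem sum_prod_wS (ε : ℝ) : ∑ u : PhasePt n, ∏ i, wS ε (u i) = 1 := by
  rw [← Fintype.prod_sum (fun (_ : Fin n) (a : ZMod 3 × ZMod 3) => wS ε a)]
  simp_rw [sum_wS]
  exact Finset.prod_const_one

/-! ### §1 Column reduction: the unital `n → 1` problem is one admissible origin column -/

/-- **Admissible origin columns** of a bistochastic `9ⁿ × 9` matrix: `0 ≤ x ≤ 1`, `9·Σ_u x u = 9ⁿ`. Set-valued data.
[cite: MarshallOlkinArnold2011, Ch. 2 §A; KoukoulekidisJennings2022, §«… unital protocols» (arXiv p. 8 L62–66)] -/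
def Col (n : ℕ) : Set (PhasePt n → ℝ) := {x | (∀ u, 0 ≤ x u ∧ x u ≤ 1) ∧ 9 * ∑ u, x u = 9 ^ n}

/-- **Column lift**: origin column `x`, the eight other columns `(1 − x)/8`. [cite: MarshallOlkinArnold2011, Ch. 2 §A] -/
def colP (x : PhasePt n → ℝ) (u : PhasePt n) (v : PhasePt 1) : ℝ := if v 0 = (0, 0) then x u else (1 - x u) / 8

/-- The column lift of an admissible column is bistochastic. [cite: MarshallOlkinArnold2011, Ch. 2 §A] -/
theorem colP_mem {x : PhasePt n → ℝ} (hx : x ∈ Col n) : colP x ∈ UStoch n 1 := by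
  obtain ⟨hb, hs⟩ := hx
  refine ⟨⟨fun u v => ?_, fun u => ?_⟩, fun v => ?_⟩
  · unfold colP; split_ifs
    · exact (hb u).1
    · linarith [(hb u).2]
  · unfold colP; rw [sum_phasePt_one_ite]; ring
  · have hc : ∑ _u : PhasePt n, (1 : ℝ) = 9 ^ n := by
      rw [Finset.sum_const, Finset.card_univ, card_phasePt, nsmul_eq_mul, mul_one]; push_cast; rfl
    unfold colP; split_ifs
    · rw [pow_one, hs]
    · rw [pow_one, ← Finset.sum_div, Finset.sum_sub_distrib, hc]
      linarith

/-- **Output of a column lift**: `Σ W·x` at the origin, `(1 − Σ W·x)/8` elsewhere. [cite: VeitchEtAl2012, §3] -/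
theorem wignerN_colP (ε : ℝ) (x : PhasePt n → ℝ) (v : PhasePt 1) :
    wignerN (ofTransition (colP x) (tensorOp fun _ : Fin n => depol ε strangeOp)) v =
      ((if v 0 = (0, 0) then ∑ u, (∏ i, wS ε (u i)) * x u
        else (1 - ∑ u, (∏ i, wS ε (u i)) * x u) / 8 : ℝ) : ℂ) := by
  rw [wignerN_ofTransition]
  simp_rw [wignerN_depolStrange_cast, ← Complex.ofReal_mul]
  rw [← Complex.ofReal_sum]
  congr 1; unfold colP; split_ifs
  · rfl
  · simp_rw [mul_div_assoc', mul_sub, mul_one]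
    rw [← Finset.sum_div, Finset.sum_sub_distrib, sum_prod_wS]

/-- **COLUMN REDUCTION.** A bistochastic `n → 1` phase-space matrix converting `𝕊_ε^{⊗n}` EXACTLY to `𝕊` exists iff
an admissible origin column of Wigner value `−1/3` exists ((→) the origin column of `P`; (←) `colP`). HONEST SCOPE:
abstract bistochastic class, positivity NOT imposed. [cite: KoukoulekidisJennings2022, Thm. 1 & §«Magic distillation
bounds for unital protocols» (arXiv p. 8 L62–66); MarshallOlkinArnold2011, Ch. 14 §A] -/
theorem exists_ustoch_iff_col (ε : ℝ) (n : ℕ) :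
    (∃ P ∈ UStoch n 1, ofTransition P (tensorOp fun _ : Fin n => depol ε strangeOp) =
      tensorOp fun _ : Fin 1 => strangeOp) ↔
    ∃ x ∈ Col n, ∑ u, (∏ i, wS ε (u i)) * x u = -1 / 3 := by
  constructor
  · rintro ⟨P, hP, hPσ⟩
    let o : PhasePt 1 := fun _ => ((0 : ZMod 3), (0 : ZMod 3))
    refine ⟨fun u => P u o, ⟨fun u => ⟨hP.1.1 u o, ?_⟩, ?_⟩, ?_⟩
    · calc P u o ≤ ∑ v, P u v := Finset.single_le_sum (fun v _ => hP.1.1 u v) (Finset.mem_univ o)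
        _ = 1 := hP.1.2 u
    · have h := hP.2 o; rwa [pow_one] at h
    · have h := re_wignerN_ofTransition P (im_depolStrange ε) o
      rw [hPσ, wignerN_strange_one_cast, Complex.ofReal_re] at h
      simp_rw [re_depolStrange] at h
      rw [← h]; norm_num [wS, o]
  · rintro ⟨x, hx, hval⟩
    refine ⟨colP x, colP_mem hx, eq_of_wignerN_eq fun v => ?_⟩
    rw [wignerN_colP, wignerN_strange_one_cast, hval]
    congr 1
    unfold wS; split_ifs <;> norm_num

/-! ### §2 LP duality for the knapsack -/

/-- **The Lagrangian dual functional** `D(τ) = 9ⁿ⁻¹·τ + Σ_u min(w u − τ, 0)` of the column knapsack (concave in the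
slope `τ`; its maximum is the LP minimum). [cite: MarshallOlkinArnold2011, Ch. 14 §B (relative Lorenz curves)] -/
def dualD (n : ℕ) (w : PhasePt n → ℝ) (τ : ℝ) : ℝ := 9 ^ n / 9 * τ + ∑ u, min (w u - τ) 0

/-- **Weak duality**: every admissible column has value `≥ D(τ)`. [cite: MarshallOlkinArnold2011, Ch. 14 §B] -/
theorem dualD_le {x : PhasePt n → ℝ} (hx : x ∈ Col n) (w : PhasePt n → ℝ) (τ : ℝ) :
    dualD n w τ ≤ ∑ u, w u * x u := by
  obtain ⟨hb, hs⟩ := hx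
  have hpt : ∀ u, min (w u - τ) 0 ≤ (w u - τ) * x u := by
    intro u
    rcases le_or_gt 0 (w u - τ) with h | h
    · exact (min_le_right _ _).trans (mul_nonneg h (hb u).1)
    · calc min (w u - τ) 0 ≤ w u - τ := min_le_left _ _
        _ = (w u - τ) * 1 := (mul_one _).symm
        _ ≤ (w u - τ) * x u := mul_le_mul_of_nonpos_left (hb u).2 h.le
  have hsum : ∑ u, x u = 9 ^ n / 9 := by rw [← hs]; ring
  calc dualD n w τ ≤ 9 ^ n / 9 * τ + ∑ u, (w u - τ) * x u :=
        add_le_add (le_refl _) (Finset.sum_le_sum fun u _ => hpt u)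
    _ = ∑ u, w u * x u := by
        simp_rw [sub_mul]
        rw [Finset.sum_sub_distrib, ← Finset.mul_sum, hsum]; ring

/-- **Bracketing**: admissible columns with values bracketing `c` give one of value `c` (convexity). [cite:
MarshallOlkinArnold2011, Ch. 2 §A] -/
theorem exists_col_of_between {w : PhasePt n → ℝ} {c : ℝ} {x y : PhasePt n → ℝ} (hx : x ∈ Col n)
    (hy : y ∈ Col n) (hxc : ∑ u, w u * x u ≤ c) (hcy : c ≤ ∑ u, w u * y u) :
    ∃ z ∈ Col n, ∑ u, w u * z u = c := by
  set A := ∑ u, w u * x u with hA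
  set B := ∑ u, w u * y u with hB
  rcases eq_or_lt_of_le (hxc.trans hcy) with hAB | hAB
  · exact ⟨x, hx, by rw [← hA]; linarith⟩
  · set θ := (c - A) / (B - A) with hθ
    have hθ0 : 0 ≤ θ := div_nonneg (by linarith) (by linarith)
    have hθ1 : θ ≤ 1 := (div_le_one (by linarith)).mpr (by linarith)
    refine ⟨fun u => (1 - θ) * x u + θ * y u, ⟨fun u => ⟨?_, ?_⟩, ?_⟩, ?_⟩
    · nlinarith [(hx.1 u).1, (hy.1 u).1]
    · nlinarith [(hx.1 u).2, (hy.1 u).2]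
    · simp_rw [Finset.sum_add_distrib, ← Finset.mul_sum]
      linear_combination (1 - θ) * hx.2 + θ * hy.2
    · have e : ∀ u, w u * ((1 - θ) * x u + θ * y u) = (1 - θ) * (w u * x u) + θ * (w u * y u) := fun u => by ring
      simp_rw [e]
      rw [Finset.sum_add_distrib, ← Finset.mul_sum, ← Finset.mul_sum, ← hA, ← hB, hθ]
      field_simp; ring

/-- **The flat column** `x ≡ 1/9` (lift `Unital.const_mem`): admissible, value `1/9`. [cite: VeitchEtAl2012, §3] -/
theorem flat_mem_Col (n : ℕ) : (fun _ : PhasePt n => (1 / 9 : ℝ)) ∈ Col n ∧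
    ∀ ε : ℝ, ∑ u : PhasePt n, (∏ i, wS ε (u i)) * (1 / 9 : ℝ) = 1 / 9 := by
  refine ⟨⟨fun _ => ⟨by norm_num, by norm_num⟩, ?_⟩, fun ε => ?_⟩
  · rw [Finset.sum_const, Finset.card_univ, card_phasePt, nsmul_eq_mul]; push_cast; ring
  · rw [← Finset.sum_mul, sum_prod_wS, one_mul]

/-- **Feasible ⇔ an admissible column reaches `≤ −1/3`** (flat partner). [cite: MarshallOlkinArnold2011, Ch. 14 §A] -/
theorem exists_col_iff_le (ε : ℝ) (n : ℕ) :
    (∃ x ∈ Col n, ∑ u, (∏ i, wS ε (u i)) * x u = -1 / 3) ↔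
      ∃ x ∈ Col n, ∑ u, (∏ i, wS ε (u i)) * x u ≤ -1 / 3 := by
  refine ⟨fun ⟨x, hx, h⟩ => ⟨x, hx, h.le⟩, fun ⟨x, hx, h⟩ => ?_⟩
  exact exists_col_of_between hx (flat_mem_Col n).1 h (by rw [(flat_mem_Col n).2 ε]; norm_num)

/-! ### §3 The Wigner levels `a^{n−k} b^k`, class and level indicators -/

/-- `a_ε = (3 − ε)/18`, the off-origin value of `W_{𝕊_ε}`. [cite: VeitchEtAl2013, §4.4] -/
def aW (ε : ℝ) : ℝ := (3 - ε) / 18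

/-- `b_ε = −(3 − 4ε)/9`, the origin value of `W_{𝕊_ε}`. [cite: VeitchEtAl2013, §4.4] -/
def bW (ε : ℝ) : ℝ := -(3 - 4 * ε) / 9

/-- `8a_ε = 1 − b_ε` (unit trace). [cite: VeitchEtAl2012, §3] -/
theorem one_sub_bW (ε : ℝ) : 1 - bW ε = 8 * aW ε := by unfold aW bW; ring

/-- `wS` in the letters `a_ε, b_ε`. [cite: VeitchEtAl2013, §4.4] -/
private theorem wS_ite (ε : ℝ) (p : ZMod 3 × ZMod 3) : wS ε p = if p = (0, 0) then bW ε else aW ε := by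
  unfold wS aW bW; split_ifs <;> ring

/-- **The origin set** of `u ∈ (ℤ₃²)ⁿ`. [cite: KoukoulekidisJennings2022, §«… unital protocols» (arXiv p. 9 L30–40)] -/
def oset (u : PhasePt n) : Finset (Fin n) := Finset.univ.filter fun j => u j = (0, 0)

/-- `∏_j (c on S, d off S) = c^{|S|}·d^{n−|S|}`. [folklore] -/
private theorem prod_ite_mem (S : Finset (Fin n)) (c d : ℝ) :
    ∏ j : Fin n, (if j ∈ S then c else d) = c ^ S.card * d ^ (n - S.card) := by
  rw [Finset.prod_ite, Finset.prod_const, Finset.prod_const, Finset.filter_mem_eq_inter, Finset.univ_inter,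
    Finset.filter_notMem_eq_sdiff, Finset.card_univ_sdiff, Fintype.card_fin]

/-- **Wigner levels**: `W_{𝕊_ε^{⊗n}}(u) = b^k·a^{n−k}`, `k = |oset u|`. [cite: KoukoulekidisJennings2022, p. 9 L30–40] -/
theorem prod_wS_eq (ε : ℝ) (u : PhasePt n) :
    ∏ i, wS ε (u i) = bW ε ^ (oset u).card * aW ε ^ (n - (oset u).card) := by
  rw [← prod_ite_mem]
  refine Finset.prod_congr rfl fun i _ => ?_
  rw [wS_ite]; simp only [oset, Finset.mem_filter, Finset.mem_univ, true_and]

/-- **Class indicator** `cls S u = 𝟙[oset u = S]` as a product over coordinates. [cite: VeitchEtAl2012, §2] -/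
def cls (S : Finset (Fin n)) (u : PhasePt n) : ℝ := ∏ j, if (j ∈ S ↔ u j = (0, 0)) then (1 : ℝ) else 0

/-- `cls S u = 𝟙[oset u = S]`. [folklore] -/
private theorem cls_eq (S : Finset (Fin n)) (u : PhasePt n) : cls S u = if oset u = S then 1 else 0 := by
  rw [cls, Fintype.prod_boole]
  have e : (∀ j, (j ∈ S ↔ u j = (0, 0))) ↔ oset u = S := by
    rw [Finset.ext_iff]; simp only [oset, Finset.mem_filter, Finset.mem_univ, true_and]
    exact ⟨fun h j => (h j).symm, fun h j => (h j).symm⟩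
  by_cases hS : oset u = S
  · rw [if_pos hS, if_pos (e.mpr hS)]
  · rw [if_neg hS, if_neg (mt e.mp hS)]

/-- **Class sizes**: `Σ_u cls S u = 8^{n − |S|}`. [cite: Gross2006, §III (`d^{2n}` points)] -/
theorem sum_cls (S : Finset (Fin n)) : ∑ u : PhasePt n, cls S u = 8 ^ (n - S.card) := by
  unfold cls
  rw [← Fintype.prod_sum (fun (j : Fin n) (a : ZMod 3 × ZMod 3) => if (j ∈ S ↔ a = (0, 0)) then (1 : ℝ) else 0)]
  have h : ∀ j : Fin n, (∑ a : ZMod 3 × ZMod 3, if (j ∈ S ↔ a = (0, 0)) then (1 : ℝ) else 0) =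
      if j ∈ S then 1 else 8 := by
    intro j
    by_cases hj : j ∈ S
    · simp only [hj, true_iff, if_true]; rw [sum_phase_ite]; norm_num
    · simp only [hj, false_iff, if_false, ite_not]; rw [sum_phase_ite]; norm_num
  simp_rw [h]
  rw [prod_ite_mem, one_pow, one_mul]

/-- **Class values**: `Σ_u W(u)·cls S u = b^{|S|}·(1 − b)^{n−|S|}`. [cite: KoukoulekidisJennings2022, §«Magic
distillation bounds for unital protocols» (arXiv p. 9 L30–40)] -/
theorem sum_wS_mul_cls (ε : ℝ) (S : Finset (Fin n)) :
    ∑ u : PhasePt n, (∏ i, wS ε (u i)) * cls S u = bW ε ^ S.card * (1 - bW ε) ^ (n - S.card) := by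
  unfold cls
  simp_rw [← Finset.prod_mul_distrib]
  rw [← Fintype.prod_sum (fun (j : Fin n) (a : ZMod 3 × ZMod 3) =>
    wS ε a * (if (j ∈ S ↔ a = (0, 0)) then (1 : ℝ) else 0))]
  have hb : wS ε (0, 0) = bW ε := by rw [wS_ite, if_pos rfl]
  have h : ∀ j : Fin n, (∑ a : ZMod 3 × ZMod 3, wS ε a * (if (j ∈ S ↔ a = (0, 0)) then (1 : ℝ) else 0)) =
      if j ∈ S then bW ε else 1 - bW ε := by
    intro j
    by_cases hj : j ∈ S
    · simp only [hj, true_iff, if_true, mul_ite, mul_one, mul_zero, Finset.sum_ite_eq', Finset.mem_univ, hb]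
    · have e : ∀ a : ZMod 3 × ZMod 3, wS ε a * (if (j ∈ S ↔ a = (0, 0)) then (1 : ℝ) else 0) =
          wS ε a - (if a = (0, 0) then wS ε a else 0) := by
        intro a; simp only [hj, false_iff]; split_ifs <;> ring
      simp_rw [e]
      rw [Finset.sum_sub_distrib, sum_wS, Finset.sum_ite_eq', if_pos (Finset.mem_univ _), hb, if_neg hj]
  simp_rw [h]
  exact prod_ite_mem S _ _

/-- **Level indicator** `lvl k u = 𝟙[|oset u| = k]` (sum of the class indicators over the `k`-subsets; the `n + 1`
Wigner LEVELS are the classes of equal origin count). [cite: KoukoulekidisJennings2022, arXiv p. 9 L30–40] -/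
def lvl (k : ℕ) (u : PhasePt n) : ℝ := ∑ S ∈ Finset.powersetCard k Finset.univ, cls S u

/-- `lvl k u = 𝟙[|oset u| = k]`. [folklore] -/
private theorem lvl_eq (k : ℕ) (u : PhasePt n) : lvl k u = if (oset u).card = k then 1 else 0 := by
  unfold lvl; simp_rw [cls_eq]
  rw [Finset.sum_ite_eq]; simp only [Finset.mem_powersetCard, Finset.subset_univ, true_and]

/-- **Level sizes**: `Σ_u lvl k u = C(n,k)·8^{n−k}`. [cite: Gross2006, §III] -/
theorem sum_lvl (k : ℕ) : ∑ u : PhasePt n, lvl k u = n.choose k * 8 ^ (n - k) := by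
  unfold lvl
  rw [Finset.sum_comm, Finset.sum_congr rfl fun S hS => by rw [sum_cls, (Finset.mem_powersetCard.mp hS).2],
    Finset.sum_const, Finset.card_powersetCard, Finset.card_univ, Fintype.card_fin, nsmul_eq_mul]

/-- **Level values**: `Σ_u W(u)·lvl k u = C(n,k)·b^k(1 − b)^{n−k}`. [cite: KoukoulekidisJennings2022, p. 9 L30–40] -/
theorem sum_wS_mul_lvl (ε : ℝ) (k : ℕ) :
    ∑ u : PhasePt n, (∏ i, wS ε (u i)) * lvl k u = n.choose k * (bW ε ^ k * (1 - bW ε) ^ (n - k)) := by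
  unfold lvl
  simp_rw [Finset.mul_sum]
  rw [Finset.sum_comm, Finset.sum_congr rfl fun S hS => by
      rw [sum_wS_mul_cls, (Finset.mem_powersetCard.mp hS).2],
    Finset.sum_const, Finset.card_powersetCard, Finset.card_univ, Fintype.card_fin, nsmul_eq_mul]

/-- `0 ≤ lvl k u + μ·lvl l u ≤ 1` for distinct levels and `0 ≤ μ ≤ 1`. [folklore] -/
private theorem lvl_add_mul_le {k l : ℕ} (hkl : k ≠ l) {μ : ℝ} (hμ0 : 0 ≤ μ) (hμ1 : μ ≤ 1) (u : PhasePt n) :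
    0 ≤ lvl k u + μ * lvl l u ∧ lvl k u + μ * lvl l u ≤ 1 := by
  rw [lvl_eq, lvl_eq]
  split_ifs <;> first | (exfalso; omega) | constructor <;> nlinarith

/-! ### §4 The law for general `n`: the symmetric weight-one column and the `|b| ≤ a` floor -/

/-- **The symmetric weight-one column** `λ·𝟙[|oset u| = 1]`, `λ = 9ⁿ⁻¹/(n·8ⁿ⁻¹)`: the greedy filling when `aⁿ⁻¹b`
is the lowest level (`3/7 ≤ ε`); admissible iff `9ⁿ⁻¹ ≤ n·8ⁿ⁻¹` (`1 ≤ n ≤ 29`). [cite: KoukoulekidisJennings2022,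
Suppl. Note 3 (arXiv p. 33: the `u > v` regime, numerical there); MarshallOlkinArnold2011, Ch. 14 §B] -/
def weightOneCol (n : ℕ) (u : PhasePt n) : ℝ := (9 : ℝ) ^ (n - 1) / (n * 8 ^ (n - 1)) * lvl 1 u

/-- The weight-one column is admissible under the capacity hypothesis. [cite: MarshallOlkinArnold2011, Ch. 14 §B] -/
theorem weightOneCol_mem (hn : 1 ≤ n) (hcap : (9 : ℝ) ^ (n - 1) ≤ n * 8 ^ (n - 1)) :
    weightOneCol n ∈ Col n := by
  have h1 : (1 : ℝ) ≤ n := by exact_mod_cast hn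
  have hpos : (0 : ℝ) < n * 8 ^ (n - 1) := by positivity
  have hl0 : 0 ≤ (9 : ℝ) ^ (n - 1) / (n * 8 ^ (n - 1)) := by positivity
  have hl1 : (9 : ℝ) ^ (n - 1) / (n * 8 ^ (n - 1)) ≤ 1 := (div_le_one hpos).mpr hcap
  refine ⟨fun u => ⟨mul_nonneg hl0 ?_, (mul_le_mul_of_nonneg_left ?_ hl0).trans (by rw [mul_one]; exact hl1)⟩, ?_⟩
  · rw [lvl_eq]; split_ifs <;> norm_num
  · rw [lvl_eq]; split_ifs <;> norm_num
  · unfold weightOneCol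
    rw [← Finset.mul_sum, sum_lvl, Nat.choose_one_right]
    obtain ⟨m, rfl⟩ : ∃ m, n = m + 1 := ⟨n - 1, by omega⟩
    have hm : (m : ℝ) + 1 ≠ 0 := by positivity
    simp only [Nat.add_sub_cancel]
    push_cast
    field_simp
    ring

/-- **Value of the weight-one column**: `9ⁿ⁻¹·aⁿ⁻¹·b`. [cite: KoukoulekidisJennings2022, §«Magic distillation bounds
for unital protocols» (arXiv p. 9 L30–40)] -/
theorem sum_wS_mul_weightOneCol (ε : ℝ) (hn : 1 ≤ n) :
    ∑ u, (∏ i, wS ε (u i)) * weightOneCol n u = 9 ^ (n - 1) * aW ε ^ (n - 1) * bW ε := by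
  unfold weightOneCol
  rw [Finset.sum_congr rfl fun u _ => mul_left_comm _ _ (lvl 1 u), ← Finset.mul_sum, sum_wS_mul_lvl,
    Nat.choose_one_right, one_sub_bW, pow_one, mul_pow]
  obtain ⟨m, rfl⟩ : ∃ m, n = m + 1 := ⟨n - 1, by omega⟩
  have hm : (m : ℝ) + 1 ≠ 0 := by positivity
  simp only [Nat.add_sub_cancel]
  push_cast
  field_simp

/-- **(←) of the law, every `1 ≤ n ≤ 29`**: `3·2ⁿ⁻¹ ≤ (3 − 4ε)(3 − ε)ⁿ⁻¹` (⇔ `9ⁿ⁻¹aⁿ⁻¹b ≤ −1/3`) gives a unital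
`n → 1` map (weight-one + flat column, bracketing). HONEST SCOPE: achievability in the ABSTRACT bistochastic class
only, positivity NOT imposed; bounds no physical protocol from below. [cite: MarshallOlkinArnold2011, Ch. 14 §B] -/
theorem exists_ustoch_of_law {ε : ℝ} (hn : 1 ≤ n) (hcap : (9 : ℝ) ^ (n - 1) ≤ n * 8 ^ (n - 1))
    (h : 3 * 2 ^ (n - 1) ≤ (3 - 4 * ε) * (3 - ε) ^ (n - 1)) :
    ∃ P ∈ UStoch n 1, ofTransition P (tensorOp fun _ : Fin n => depol ε strangeOp) =
      tensorOp fun _ : Fin 1 => strangeOp := by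
  rw [exists_ustoch_iff_col, exists_col_iff_le]
  refine ⟨weightOneCol n, weightOneCol_mem hn hcap, ?_⟩
  rw [sum_wS_mul_weightOneCol ε hn]
  obtain ⟨m, rfl⟩ : ∃ m, n = m + 1 := ⟨n - 1, by omega⟩
  simp only [Nat.add_sub_cancel] at h ⊢
  have e : (9 : ℝ) ^ m * aW ε ^ m * bW ε = -((3 - 4 * ε) * (3 - ε) ^ m) / (9 * 2 ^ m) := by
    unfold aW bW
    rw [div_pow, show (18 : ℝ) ^ m = 2 ^ m * 9 ^ m by rw [← mul_pow]; norm_num]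
    field_simp
  rw [e, div_le_iff₀ (by positivity)]
  linarith

/-- **The `|b| ≤ a` floor**: on `3/7 ≤ ε ≤ 3/4` every level lies in `[aⁿ⁻¹b, aⁿ]` (`n = m + 1`). [cite:
KoukoulekidisJennings2022, Suppl. Note 3 (arXiv p. 33, `u > v`)] -/
private theorem prod_wS_bounds {ε : ℝ} (h37 : 3 / 7 ≤ ε) (h34 : ε ≤ 3 / 4) (m : ℕ) (u : PhasePt (m + 1)) :
    aW ε ^ m * bW ε ≤ ∏ i, wS ε (u i) ∧ ∏ i, wS ε (u i) ≤ aW ε ^ (m + 1) := by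
  have ha : 0 ≤ aW ε := by unfold aW; linarith
  have hb : bW ε ≤ 0 := by unfold bW; linarith
  have hab : 0 ≤ aW ε + bW ε := by unfold aW bW; linarith
  have hbb : bW ε * bW ε ≤ aW ε * aW ε := by nlinarith [mul_nonneg (neg_nonneg.mpr hb) hab, mul_nonneg ha hab]
  revert u
  induction m with
  | zero =>
    intro u
    rw [Fin.prod_univ_one, wS_ite, pow_zero, one_mul, zero_add, pow_one]
    split_ifs
    · exact ⟨le_refl _, by linarith⟩
    · exact ⟨by linarith, le_refl _⟩
  | succ m ih =>
    intro u
    obtain ⟨hlo, hhi⟩ := ih (fun i => u i.succ)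
    rw [Fin.prod_univ_succ, wS_ite]
    split_ifs
    · constructor
      · calc aW ε ^ (m + 1) * bW ε = bW ε * aW ε ^ (m + 1) := mul_comm _ _
          _ ≤ bW ε * ∏ i : Fin (m + 1), wS ε (u i.succ) := mul_le_mul_of_nonpos_left hhi hb
      · calc bW ε * ∏ i : Fin (m + 1), wS ε (u i.succ) ≤ bW ε * (aW ε ^ m * bW ε) :=
            mul_le_mul_of_nonpos_left hlo hb
          _ = (bW ε * bW ε) * aW ε ^ m := by ring
          _ ≤ (aW ε * aW ε) * aW ε ^ m := mul_le_mul_of_nonneg_right hbb (pow_nonneg ha m)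
          _ = aW ε ^ (m + 1 + 1) := by ring
    · constructor
      · calc aW ε ^ (m + 1) * bW ε = aW ε * (aW ε ^ m * bW ε) := by ring
          _ ≤ aW ε * ∏ i : Fin (m + 1), wS ε (u i.succ) := mul_le_mul_of_nonneg_left hlo ha
      · calc aW ε * ∏ i : Fin (m + 1), wS ε (u i.succ) ≤ aW ε * aW ε ^ (m + 1) :=
            mul_le_mul_of_nonneg_left hhi ha
          _ = aW ε ^ (m + 1 + 1) := by ring

/-- **(→) of the law on `3/7 ≤ ε ≤ 3/4`, every `n ≥ 1`**: a unital `n → 1` map forces `3·2ⁿ⁻¹ ≤ (3 − 4ε)(3 − ε)ⁿ⁻¹`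
— DUAL certificate: the lowest rescaled level `9ⁿaⁿ⁻¹b` is a floor for `9·W_𝕊(0) = −3` (`Unital.floor_map`).
HONEST SCOPE: constrains every maximally-mixed-preserving free operation with these exact states; ancilla-assisted
/ postselected protocols NOT constrained; `d = 3`. [cite: KoukoulekidisJennings2022, Thm. 1 & Suppl. Note 3 (p. 33)] -/
theorem law_of_exists_ustoch {ε : ℝ} (h37 : 3 / 7 ≤ ε) (h34 : ε ≤ 3 / 4) (hn : 1 ≤ n)
    (h : ∃ P ∈ UStoch n 1, ofTransition P (tensorOp fun _ : Fin n => depol ε strangeOp) =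
      tensorOp fun _ : Fin 1 => strangeOp) :
    3 * 2 ^ (n - 1) ≤ (3 - 4 * ε) * (3 - ε) ^ (n - 1) := by
  obtain ⟨m, rfl⟩ : ∃ m, n = m + 1 := ⟨n - 1, by omega⟩
  simp only [Nat.add_sub_cancel]
  obtain ⟨P, hP, hPσ⟩ := h
  have hc : ∀ u : PhasePt (m + 1), 9 ^ (m + 1) * (aW ε ^ m * bW ε) ≤
      9 ^ (m + 1) * (wignerN (tensorOp fun _ : Fin (m + 1) => depol ε strangeOp) u).re := by
    intro u
    rw [re_depolStrange]
    exact mul_le_mul_of_nonneg_left (prod_wS_bounds h37 h34 m u).1 (by positivity)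
  have hfl := floor_map hP (im_depolStrange ε) hc (fun _ : Fin 1 => ((0 : ZMod 3), (0 : ZMod 3)))
  rw [hPσ, wignerN_strange_one_cast, Complex.ofReal_re, pow_one] at hfl
  have e : (9 : ℝ) ^ (m + 1) * (aW ε ^ m * bW ε) = -((3 - 4 * ε) * (3 - ε) ^ m) / 2 ^ m := by
    unfold aW bW
    rw [div_pow, pow_succ, show (18 : ℝ) ^ m = 2 ^ m * 9 ^ m by rw [← mul_pow]; norm_num]
    field_simp
  rw [e, div_le_iff₀ (by positivity)] at hfl
  norm_num [wS] at hfl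
  linarith

/-- **The law holds outright on `ε ≤ 3/7` once `n ≥ 5`** (`(9/7)⁵ = 59049/16807 ≥ 3`). [cite:
KoukoulekidisJennings2022, §«Magic distillation bounds for unital protocols» (arXiv p. 9 L30–62)] -/
theorem law_of_le_three_sevenths {ε : ℝ} (h37 : ε ≤ 3 / 7) (h5 : 5 ≤ n) :
    3 * 2 ^ (n - 1) ≤ (3 - 4 * ε) * (3 - ε) ^ (n - 1) := by
  obtain ⟨m, rfl⟩ : ∃ m, n = m + 1 := ⟨n - 1, by omega⟩
  simp only [Nat.add_sub_cancel]
  have h1 : (18 / 7 : ℝ) ^ m ≤ (3 - ε) ^ m := pow_le_pow_left₀ (by norm_num) (by linarith) m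
  have h2 : (3 : ℝ) ≤ (9 / 7) ^ (m + 1) :=
    le_trans (by norm_num) (pow_le_pow_right₀ (by norm_num : (1 : ℝ) ≤ 9 / 7) (by omega : 5 ≤ m + 1))
  calc (3 : ℝ) * 2 ^ m ≤ (9 / 7) ^ (m + 1) * 2 ^ m := mul_le_mul_of_nonneg_right h2 (by positivity)
    _ = 9 / 7 * (18 / 7) ^ m := by
        rw [pow_succ, show (18 / 7 : ℝ) ^ m = (9 / 7) ^ m * 2 ^ m by rw [← mul_pow]; norm_num]; ring
    _ ≤ (3 - 4 * ε) * (3 - ε) ^ m := mul_le_mul (by linarith) h1 (by positivity) (by linarith)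

/-- **HEADLINE — the unital `n → 1` threshold law, `5 ≤ n ≤ 29`.** For `ε ≤ 3/4`, `5 ≤ n` and under the VISIBLE
capacity hypothesis `9ⁿ⁻¹ ≤ n·8ⁿ⁻¹` (true exactly for `1 ≤ n ≤ 29`), an abstract bistochastic (free-polytope- AND
maximally-mixed-preserving, ℂ-linear) phase-space map takes `𝕊_ε^{⊗n}` EXACTLY to `𝕊` iff
`3·2ⁿ⁻¹ ≤ (3 − 4ε)(3 − ε)ⁿ⁻¹`; the root `ρ_n` increases to `3/4` (`ρ₅ ≈ 0.46117`, `ρ₆ ≈ 0.50284`, `ρ₈ ≈ 0.56232`,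
`ρ₁₂ ≈ 0.63265`, `ρ₂₀ ≈ 0.69811`, `ρ₂₉ ≈ 0.72871`), against the abstract-class law `5/3 ≤ (5/3 − 8ε/9)ⁿ` of
`Blocklength.blocklength_iff` (`n = 5`: `≈ 0.62899`). (→): `law_of_exists_ustoch` on `3/7 ≤ ε`,
`law_of_le_three_sevenths` on `ε ≤ 3/7`; (←): `exists_ustoch_of_law`. SMALL `n`: for `n = 2` the same law is
`Unital.unital_two_to_one_iff` (all `0 ≤ ε ≤ 3/4`); for `n = 3, 4` it FAILS below `3/7` (§5: the origin-count-3
level undercuts `aⁿ⁻¹b` when `|b| > a`), and holds again from `n = 5` on. RANGE: nothing is claimed for `n ≥ 30`, where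
the symmetric weight-one column is inadmissible (`9ⁿ⁻¹ > n·8ⁿ⁻¹`; a second level would be needed) — the law is then
NOT asserted either way. HONEST SCOPE: abstract ℂ-linear bistochastic maps, positivity / complete positivity NOT
imposed ⇒ (←) is achievability in the ABSTRACT unital class only and bounds no physical protocol from below; (→)
constrains every maximally-mixed-preserving free operation; ancilla-assisted / postselected protocols NOT
constrained; target exactly `𝕊`; `d = 3`. [cite: KoukoulekidisJennings2022, Thm. 1 & §«Magic distillation bounds for
unital protocols» (arXiv p. 9 L30–62: `n` even and `ε ≤ 3/7` assumed there, `R_num` numerical) & Suppl. Note 3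
(p. 33 L11–12: the `u > v` regime); MarshallOlkinArnold2011, Ch. 14 §A–B] -/
theorem unital_blocklength_law {ε : ℝ} (h34 : ε ≤ 3 / 4) (h5 : 5 ≤ n)
    (hcap : (9 : ℝ) ^ (n - 1) ≤ n * 8 ^ (n - 1)) :
    (∃ P ∈ UStoch n 1, ofTransition P (tensorOp fun _ : Fin n => depol ε strangeOp) =
      tensorOp fun _ : Fin 1 => strangeOp) ↔ 3 * 2 ^ (n - 1) ≤ (3 - 4 * ε) * (3 - ε) ^ (n - 1) := by
  refine ⟨fun h => ?_, exists_ustoch_of_law (by omega) hcap⟩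
  rcases le_or_gt (3 / 7 : ℝ) ε with h37 | h37
  · exact law_of_exists_ustoch h37 h34 (by omega) h
  · exact law_of_le_three_sevenths h37.le h5

/-! ### §5 Rows `n = 3, 4`: greedy columns and dual floors on `ε ≤ 3/7` -/

/-- **Dual floor for `n ∈ {3, 4}` on `ε ≤ 3/7`** (`|b| ≥ a`): with the slope `τ⋆ = aⁿ⁻¹b` only the origin-count-3
level lies below `τ⋆`, so every admissible column has value `≥ 9ⁿ⁻¹aⁿ⁻¹b + C(n,3)8ⁿ⁻³(aⁿ⁻³b³ − aⁿ⁻¹b)` (`dualD_le`).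
[cite: KoukoulekidisJennings2022, Thm. 1 & §«Magic distillation bounds for unital protocols» (arXiv p. 9 L30–40:
levels sorted by parity of the origin count); MarshallOlkinArnold2011, Ch. 14 §B] -/
theorem dual_floor_small {ε : ℝ} (h37 : ε ≤ 3 / 7) (hn3 : 3 ≤ n) (hn4 : n ≤ 4) {x : PhasePt n → ℝ} (hx : x ∈ Col n) :
    9 ^ n / 9 * (aW ε ^ (n - 1) * bW ε) +
        n.choose 3 * 8 ^ (n - 3) * (aW ε ^ (n - 3) * bW ε ^ 3 - aW ε ^ (n - 1) * bW ε) ≤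
      ∑ u, (∏ i, wS ε (u i)) * x u := by
  have ha : 0 ≤ aW ε := by unfold aW; linarith
  have hb : bW ε ≤ 0 := by unfold bW; linarith
  have hab : aW ε + bW ε ≤ 0 := by unfold aW bW; linarith
  refine le_trans ?_ (dualD_le hx _ (aW ε ^ (n - 1) * bW ε))
  rw [dualD, ← sum_lvl, Finset.sum_mul]
  refine add_le_add (le_refl _) (Finset.sum_le_sum fun u _ => ?_)
  rw [prod_wS_eq, lvl_eq]
  obtain ⟨m, rfl⟩ : ∃ m, n = m + 3 := ⟨n - 3, by omega⟩
  simp only [show m + 3 - 3 = m from by omega, show m + 3 - 1 = m + 2 from by omega]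
  split_ifs with hk
  · rw [hk, show m + 3 - 3 = m from by omega, one_mul]
    have hneg : bW ε ^ 3 * aW ε ^ m - aW ε ^ (m + 2) * bW ε ≤ 0 := by
      rw [show bW ε ^ 3 * aW ε ^ m - aW ε ^ (m + 2) * bW ε =
          aW ε ^ m * (bW ε * (bW ε - aW ε)) * (bW ε + aW ε) by ring]
      exact mul_nonpos_of_nonneg_of_nonpos
        (mul_nonneg (pow_nonneg ha m) (mul_nonneg_of_nonpos_of_nonpos hb (by linarith))) (by linarith)
    rw [min_eq_left hneg]; exact le_of_eq (by ring)
  · rw [zero_mul]; refine le_min ?_ (le_refl 0)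
    rcases Nat.even_or_odd (oset u).card with he | ho
    · nlinarith [mul_nonneg (he.pow_nonneg (bW ε)) (pow_nonneg ha (m + 3 - (oset u).card)),
        mul_nonneg (pow_nonneg ha (m + 2)) (neg_nonneg.mpr hb)]
    · have hk1 : (oset u).card = 1 := by
        have hc := Finset.card_le_univ (oset u); rw [Fintype.card_fin] at hc; obtain ⟨j, hj⟩ := ho; omega
      rw [hk1, pow_one, show m + 3 - 1 = m + 2 from by omega]
      linarith

/-- **The greedy column for `n ∈ {3, 4}` on `ε ≤ 3/7`**: the origin-count-3 level filled, the origin-count-1 level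
to height `μ` (`μ₃ = 5/12`; `μ₄ = 697/2048` gives the `n = 4` row `0 ≤ 1220ε⁴ − 7799ε³ + 18135ε² − 19629ε + 5481`,
`ρ₄ ≈ 0.40744`, NOT filed here). [cite: MarshallOlkinArnold2011, Ch. 14 §B] -/
def greedyCol (n : ℕ) (μ : ℝ) (u : PhasePt n) : ℝ := lvl 3 u + μ * lvl 1 u

/-- Admissibility of the greedy column. [cite: MarshallOlkinArnold2011, Ch. 14 §B] -/
theorem greedyCol_mem {μ : ℝ} (hμ0 : 0 ≤ μ) (hμ1 : μ ≤ 1)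
    (hsum : 9 * (n.choose 3 * 8 ^ (n - 3) + μ * (n * 8 ^ (n - 1))) = (9 : ℝ) ^ n) :
    greedyCol n μ ∈ Col n := by
  refine ⟨lvl_add_mul_le (by norm_num) hμ0 hμ1, ?_⟩
  unfold greedyCol
  rw [Finset.sum_add_distrib, ← Finset.mul_sum, sum_lvl, sum_lvl, Nat.choose_one_right]
  exact hsum

/-- Value of the greedy column: `C(n,3)b³(1−b)ⁿ⁻³ + μ·n·b(1−b)ⁿ⁻¹`. [cite: MarshallOlkinArnold2011, Ch. 14 §B] -/
theorem sum_wS_mul_greedyCol (ε μ : ℝ) :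
    ∑ u, (∏ i, wS ε (u i)) * greedyCol n μ u =
      n.choose 3 * (bW ε ^ 3 * (1 - bW ε) ^ (n - 3)) + μ * (n * (bW ε * (1 - bW ε) ^ (n - 1))) := by
  unfold greedyCol
  have e : ∀ u : PhasePt n, (∏ i, wS ε (u i)) * (lvl 3 u + μ * lvl 1 u) =
      (∏ i, wS ε (u i)) * lvl 3 u + μ * ((∏ i, wS ε (u i)) * lvl 1 u) := fun u => by ring
  simp_rw [e]
  rw [Finset.sum_add_distrib, ← Finset.mul_sum, sum_wS_mul_lvl, sum_wS_mul_lvl, Nat.choose_one_right, pow_one]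

/-- **HEADLINE — the exact unital `3 → 1` region.** For `ε ≤ 3/4`, an abstract bistochastic (free-polytope- AND
maximally-mixed-preserving, ℂ-linear) phase-space map takes `𝕊_ε^{⊗3}` EXACTLY to `𝕊` iff `4ε³ − 19ε² + 33ε ≤ 9`
(`ρ₃ ≈ 0.33163`; abstract class `≈ 0.54117`, `Blocklength.blocklength_iff`). On `ε ≤ 3/7`: (→) DUAL slope `a²b`
(`dual_floor_small`), (←) PRIMAL `greedyCol 3 (5/12)`, via `b³ + 80a²b + 1/3 = (4/81)(4ε³ − 19ε² + 33ε − 9)`; on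
`3/7 ≤ ε ≤ 3/4` both sides fail (`law_of_exists_ustoch`: `(3 − 4ε)(3 − ε)² ≤ 2916/343 < 12`). HONEST SCOPE: abstract
ℂ-linear bistochastic maps, positivity / complete positivity NOT imposed ⇒ (←) is achievability in the ABSTRACT
unital class only and bounds no physical protocol from below; (→) constrains every maximally-mixed-preserving free
operation; ancilla-assisted / postselected protocols NOT constrained; target exactly `𝕊`; `d = 3`. [cite:
KoukoulekidisJennings2022, Thm. 1 & §«Magic distillation bounds for unital protocols» (arXiv p. 9 L30–62) & Suppl.
Note 3 (p. 33); MarshallOlkinArnold2011, Ch. 14 §A–B] -/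
theorem unital_three_to_one_iff {ε : ℝ} (h34 : ε ≤ 3 / 4) :
    (∃ P ∈ UStoch 3 1, ofTransition P (tensorOp fun _ : Fin 3 => depol ε strangeOp) =
      tensorOp fun _ : Fin 1 => strangeOp) ↔ 4 * ε ^ 3 - 19 * ε ^ 2 + 33 * ε ≤ 9 := by
  have iden : bW ε ^ 3 + 80 * aW ε ^ 2 * bW ε + 1 / 3 = 4 / 81 * (4 * ε ^ 3 - 19 * ε ^ 2 + 33 * ε - 9) := by
    unfold aW bW; ring
  have h33 : Nat.choose 3 3 = 1 := Nat.choose_self 3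
  rcases le_or_gt ε (3 / 7) with h37 | h37
  · rw [exists_ustoch_iff_col]
    constructor
    · rintro ⟨x, hx, hval⟩
      have hd := dual_floor_small h37 (le_refl 3) (by norm_num) hx
      rw [hval, h33] at hd
      norm_num at hd; nlinarith [hd, iden]
    · intro h
      rw [exists_col_iff_le]
      refine ⟨greedyCol 3 (5 / 12), greedyCol_mem (by norm_num) (by norm_num) (by rw [h33]; norm_num), ?_⟩
      rw [sum_wS_mul_greedyCol, one_sub_bW, h33]
      norm_num; nlinarith [iden, h]
  · have hB : (3 - 4 * ε) * (3 - ε) ^ 2 ≤ 9 / 7 * (18 / 7) ^ 2 :=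
      mul_le_mul (by linarith) (pow_le_pow_left₀ (by linarith) (by linarith) 2) (by positivity) (by norm_num)
    constructor
    · intro h
      have hl := law_of_exists_ustoch h37.le h34 (by norm_num) h
      norm_num at hl hB; linarith
    · intro h
      nlinarith [mul_nonneg (sub_nonneg.2 h37.le) (sq_nonneg (ε - 121 / 56))]

/-- **No unital `4 → 1` map on `3/7 ≤ ε ≤ 3/4`** (`(3 − 4ε)(3 − ε)³ ≤ 52488/2401 < 24`). HONEST SCOPE as in
`unital_three_to_one_iff`. [cite: KoukoulekidisJennings2022, Suppl. Note 3 (arXiv p. 33)] -/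
theorem not_unital_four_to_one {ε : ℝ} (h37 : 3 / 7 ≤ ε) (h34 : ε ≤ 3 / 4) :
    ¬ ∃ P ∈ UStoch 4 1, ofTransition P (tensorOp fun _ : Fin 4 => depol ε strangeOp) =
      tensorOp fun _ : Fin 1 => strangeOp := by
  intro h
  have hl := law_of_exists_ustoch h37 h34 (by norm_num) h
  have hB : (3 - 4 * ε) * (3 - ε) ^ 3 ≤ 9 / 7 * (18 / 7) ^ 3 :=
    mul_le_mul (by linarith) (pow_le_pow_left₀ (by linarith) (by linarith) 3) (pow_nonneg (by linarith) 3)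
      (by norm_num)
  norm_num at hl hB; linarith

/-! ### §6 The crossover `ε = 3/7` and rational rows of the ladder -/

/-- **HEADLINE — the crossover `ε = 3/7` (`|b| = a`): unital blocklength EXACTLY 5, abstract blocklength EXACTLY 3.**
Abstract free class: `𝕊_{3/7}^{⊗3} ↦ 𝕊` yes, `𝕊_{3/7}^{⊗2} ↦ 𝕊` no (`Blocklength.blocklength_iff`, base `9/7`); unital
sub-class: `n = 5` yes (`48 ≤ (9/7)(18/7)⁴`), `n = 4, 3, 2` no (`n = 2` by `Unital.unital_two_to_one_iff`). HONEST
SCOPE: abstract ℂ-linear phase-space maps on both sides, positivity NOT imposed; the positive conjuncts bound no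
physical protocol from below; `d = 3`. [cite: KoukoulekidisJennings2022, §«… unital protocols» (arXiv p. 9), Fig. 3] -/
theorem crossover_three_sevenths :
    (∃ Λ : Matrix (TReg 3) (TReg 3) ℂ →ₗ[ℂ] Matrix (TReg 1) (TReg 1) ℂ, Set.MapsTo Λ (WPos 3) (WPos 1) ∧
        Λ (tensorOp fun _ : Fin 3 => depol (3 / 7) strangeOp) = tensorOp fun _ : Fin 1 => strangeOp) ∧
    (¬ ∃ Λ : Matrix (TReg 2) (TReg 2) ℂ →ₗ[ℂ] Matrix (TReg 1) (TReg 1) ℂ, Set.MapsTo Λ (WPos 2) (WPos 1) ∧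
        Λ (tensorOp fun _ : Fin 2 => depol (3 / 7) strangeOp) = tensorOp fun _ : Fin 1 => strangeOp) ∧
    (∃ P ∈ UStoch 5 1, ofTransition P (tensorOp fun _ : Fin 5 => depol (3 / 7) strangeOp) =
        tensorOp fun _ : Fin 1 => strangeOp) ∧
    (¬ ∃ P ∈ UStoch 4 1, ofTransition P (tensorOp fun _ : Fin 4 => depol (3 / 7) strangeOp) =
        tensorOp fun _ : Fin 1 => strangeOp) ∧
    (¬ ∃ P ∈ UStoch 3 1, ofTransition P (tensorOp fun _ : Fin 3 => depol (3 / 7) strangeOp) =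
        tensorOp fun _ : Fin 1 => strangeOp) ∧
    ¬ ∃ P ∈ UStoch 2 1, ofTransition P (tensorOp fun _ : Fin 2 => depol (3 / 7) strangeOp) =
        tensorOp fun _ : Fin 1 => strangeOp :=
  ⟨(Completeness.Blocklength.blocklength_iff (by norm_num) 3).mpr (by norm_num),
    fun h => absurd ((Completeness.Blocklength.blocklength_iff (by norm_num) 2).mp h) (by norm_num),
    (unital_blocklength_law (by norm_num) (le_refl 5) (by norm_num)).mpr (by norm_num), not_unital_four_to_one le_rfl
      (by norm_num), fun h => absurd ((unital_three_to_one_iff (by norm_num)).mp h) (by norm_num),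
    fun h => absurd ((unital_two_to_one_iff ⟨by norm_num, by norm_num⟩).mp h) (by norm_num)⟩

/-- **Rational rows** bracketing `ρ₃ ≈ 0.33163`, `ρ₅ ≈ 0.46117` as YES / NO pairs (`3 → 1`: `33/100` · `1/3`; `5 → 1`:
`23/50` · `47/100`). HONEST SCOPE as in `unital_blocklength_law`. [cite: KoukoulekidisJennings2022, arXiv p. 9] -/
theorem unital_rows :
    (∃ P ∈ UStoch 3 1, ofTransition P (tensorOp fun _ : Fin 3 => depol (33 / 100) strangeOp) =
        tensorOp fun _ : Fin 1 => strangeOp) ∧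
    (¬ ∃ P ∈ UStoch 3 1, ofTransition P (tensorOp fun _ : Fin 3 => depol (1 / 3) strangeOp) =
        tensorOp fun _ : Fin 1 => strangeOp) ∧
    (∃ P ∈ UStoch 5 1, ofTransition P (tensorOp fun _ : Fin 5 => depol (23 / 50) strangeOp) =
        tensorOp fun _ : Fin 1 => strangeOp) ∧
    ¬ ∃ P ∈ UStoch 5 1, ofTransition P (tensorOp fun _ : Fin 5 => depol (47 / 100) strangeOp) =
        tensorOp fun _ : Fin 1 => strangeOp :=
  ⟨(unital_three_to_one_iff (by norm_num)).mpr (by norm_num),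
    fun h => absurd ((unital_three_to_one_iff (by norm_num)).mp h) (by norm_num),
    (unital_blocklength_law (by norm_num) (le_refl 5) (by norm_num)).mpr (by norm_num),
    fun h => absurd ((unital_blocklength_law (by norm_num) (le_refl 5) (by norm_num)).mp h) (by norm_num)⟩

end Literature.Computability.QuantumComplexity.QutritWigner.Completeness.Unital.Blocklength
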